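import Summits.RiemannHypothesis.RiemannHypothesis.Theorems.PfPersistenceM2Thermometer
import Summits.RiemannHypothesis.RiemannHypothesis.Theorems.WeilWindowFlowDiniGlue
import Summits.RiemannHypothesis.RiemannHypothesis.Theorems.WeilParityEvenWinsBeyondArchStubSectorContinuity
import Literature.NumberTheory.LFunctions.WeilWindowSuzukiContinuityProofs

/-!
# CAND SEAT 3 gen 2 (pub-rhpf-cand-3-g2) — the NON-VANISHING SINK (row C3-N3)

mechanism/rigidity campaign; no RH claims.  Third (Z)-sink for ∀a-invariants of the cell, next to
the FLOOR/thermometer sink (`riemannHypothesis_of_evenGroundEnergy_floor`) and the T1 sink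
(`riemannHypothesis_of_evenOneSigned_cofinal`): **any window invariant `K` that is false whenever
the window bottom vanishes is RH-strength as soon as it holds at every window** — by the
intermediate value theorem along the window parameter `a` (continuity of the bottom: Suzuki,
PROVED in tree as `continuousAt_weilGroundEnergy`, and sectorwise as
`stub_sectorContinuity_continuousAt_even/odd` (Bombieri 2000 Thm 5, file
`Theorems/WeilParityEvenWinsBeyondArchStubSectorContinuity.lean`); anchor `ε(a₀) ≥ 1` at small
windows: Bombieri coercivity, PROVED as `exists_one_le_weilGroundEnergy`, inherited by the even
sector through `weilGroundEnergy_le_weilEvenGroundEnergy`; Yoshida's criterion).  ALL sinks below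
are therefore UNCONDITIONAL tree consequences (no hypothesis beyond the invariant itself).  In print: Yoshida 1992
(RH ⟺ non-degeneracy of the Weil hermitian form on K̂(a) for every a) and Suzuki 2023
(arXiv:2206.03682, Thm 1.4).  By the same IVT such a `K` is GLOBALLY SOUND on every family whose
bottom is continuous in `a`, positive at some window and negative at a later one (the ∀a-form fails
at the crossing window) — global soundness and RH-strength are the two faces of one coin here.
Instance: the two-sided bottom-step band of harness candidate `cand3-006`
(`0 < lg(ε₂/|ε₁|) − lg(ε₃/ε₂) ≤ Σ`), whose upper side excludes `ε₁ = 0` (stated inline, no new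
definition).
-/

open Filter Topology Set
open Literature.NumberTheory.LFunctions

namespace Summit.RiemannHypothesis.RiemannHypothesis.Theorems.PfPersistenceCand3NonvanishingSink

open Summit.RiemannHypothesis.RiemannHypothesis.Theorems.PfPersistenceM2
open Summit.RiemannHypothesis.RiemannHypothesis.Theorems.WeilWindowFlowDiniGlue

/-- **Non-vanishing sink (full bottom).**  If the window bottom `ε(a) = weilGroundEnergy a` is
non-zero at every window `a > 0`, then RH.  [Yoshida 1992; Suzuki 2023 Thm 1.4 — here from tree
facts: continuity (Suzuki), coercive anchor (Bombieri), Yoshida's criterion.] -/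
theorem riemannHypothesis_of_weilGroundEnergy_ne_zero
    (h : ∀ a : ℝ, 0 < a → weilGroundEnergy a ≠ 0) : _root_.RiemannHypothesis := by
  rw [riemannHypothesis_iff_forall_weilPositivityOn]
  intro a ha
  rw [← weilGroundEnergy_nonneg_iff_holds ha]
  by_contra hneg
  push Not at hneg
  obtain ⟨a₀, ha₀, hanch⟩ := exists_one_le_weilGroundEnergy
  have hb0 : 0 < min a₀ a := lt_min ha₀ ha
  have hba : min a₀ a ≤ a := min_le_right _ _
  have hb1 : 1 ≤ weilGroundEnergy (min a₀ a) := hanch _ hb0 (min_le_left _ _)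
  have hcont : ContinuousOn weilGroundEnergy (Icc (min a₀ a) a) :=
    continuousOn_of_forall_continuousAt fun x hx ↦
      continuousAt_weilGroundEnergy (hb0.trans_le hx.1)
  have hmem : (0 : ℝ) ∈ Icc (weilGroundEnergy a) (weilGroundEnergy (min a₀ a)) :=
    ⟨hneg.le, by linarith⟩
  obtain ⟨c, hc, hc0⟩ := intermediate_value_Icc' hba hcont hmem
  exact h c (hb0.trans_le hc.1) hc0

/-- The sink in the shape the harness uses: a window invariant `K` that excludes a vanishing
bottom is RH-strength once it holds at every window. -/
theorem riemannHypothesis_of_forall_excluding_zero {K : ℝ → Prop}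
    (hK : ∀ a : ℝ, 0 < a → K a → weilGroundEnergy a ≠ 0) (h : ∀ a : ℝ, 0 < a → K a) :
    _root_.RiemannHypothesis :=
  riemannHypothesis_of_weilGroundEnergy_ne_zero fun a ha ↦ hK a ha (h a ha)

/-- `cand3-006` at one window and one sector: the two-sided bottom-step band
`ε₂²/s ≤ |ε₁|·ε₃ < ε₂²` with `ε₂, ε₃ > 0` (`s = 10^Σ`), i.e. `0 < lg(ε₂/|ε₁|) − lg(ε₃/ε₂) ≤ Σ` —
sign-blind in `ε₁`, scale-free — has an upper side that excludes `ε₁ = 0`.  (Stated with the band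
as four inline hypotheses; no new definition is introduced in `Theorems/`.) -/
theorem ne_zero_of_bottomStepBand {s ε₁ ε₂ ε₃ : ℝ} (h2 : 0 < ε₂)
    (hup : ε₂ ^ 2 ≤ s * (|ε₁| * ε₃)) : ε₁ ≠ 0 := by
  rintro rfl
  have : (0 : ℝ) < ε₂ ^ 2 := by positivity
  simp at hup
  linarith

/-- **Even-sector, eventual form** (the harness's `P` is sectorwise), with the window continuity
as an explicit hypothesis `hcont` (discharged below by the tree's
`stub_sectorContinuity_continuousAt_even`); the anchor is one non-negative value at the start of
the regime.  Then non-vanishing on `[A, ∞)` gives RH via the tree thermometer with `σ ≡ 0`. -/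
theorem riemannHypothesis_of_even_ne_zero_from
    (hcont : ∀ a : ℝ, 0 < a → ContinuousAt weilEvenGroundEnergy a)
    {A : ℝ} (hA : 0 < A) (hpos : 0 ≤ weilEvenGroundEnergy A)
    (h : ∀ a : ℝ, A ≤ a → weilEvenGroundEnergy a ≠ 0) : _root_.RiemannHypothesis := by
  have hposA : 0 < weilEvenGroundEnergy A := lt_of_le_of_ne hpos (h A le_rfl).symm
  have hnn : ∀ a : ℝ, A ≤ a → 0 ≤ weilEvenGroundEnergy a := by
    intro a hAa
    by_contra hneg
    push Not at hneg
    have hc : ContinuousOn weilEvenGroundEnergy (Icc A a) :=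
      continuousOn_of_forall_continuousAt fun x hx ↦ hcont x (hA.trans_le hx.1)
    have hmem : (0 : ℝ) ∈ Icc (weilEvenGroundEnergy a) (weilEvenGroundEnergy A) :=
      ⟨hneg.le, hposA.le⟩
    obtain ⟨c, hc1, hc0⟩ := intermediate_value_Icc' hAa hc hmem
    exact h c hc1.1 hc0
  refine riemannHypothesis_of_evenGroundEnergy_floor (a := fun k : ℕ ↦ A + k) (σ := fun _ ↦ 0)
    (tendsto_atTop_add_const_left _ _ tendsto_natCast_atTop_atTop) tendsto_const_nhds ?_
  exact Eventually.of_forall fun k ↦ by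
    have := hnn (A + k) (by simp)
    simpa using this

/-- The band instance of the sink (even sector): a two-sided bottom-step band at every window of
`[A, ∞)` against any positive levels, plus even-window continuity and one non-negative value at
`A`, gives RH.  This is the (Z)-label of GAP-CLASSES row C3-I4 in kernel form. -/
theorem riemannHypothesis_of_bottomStepBand_from
    (hcont : ∀ a : ℝ, 0 < a → ContinuousAt weilEvenGroundEnergy a)
    {A : ℝ} (hA : 0 < A) (hpos : 0 ≤ weilEvenGroundEnergy A) {s : ℝ} {e₂ e₃ : ℝ → ℝ}
    (h : ∀ a : ℝ, A ≤ a → 0 < e₂ a ∧ 0 < e₃ a ∧ |weilEvenGroundEnergy a| * e₃ a < e₂ a ^ 2 ∧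
      e₂ a ^ 2 ≤ s * (|weilEvenGroundEnergy a| * e₃ a)) :
    _root_.RiemannHypothesis :=
  riemannHypothesis_of_even_ne_zero_from hcont hA hpos fun a ha ↦
    ne_zero_of_bottomStepBand (h a ha).1 (h a ha).2.2.2

/-- **Even-sector, eventual form, unconditional**: continuity supplied by the tree
(`stub_sectorContinuity_continuousAt_even`, Bombieri 2000 Thm 5 / Suzuki dilation modulus). -/
theorem riemannHypothesis_of_even_ne_zero_from' {A : ℝ} (hA : 0 < A)
    (hpos : 0 ≤ weilEvenGroundEnergy A) (h : ∀ a : ℝ, A ≤ a → weilEvenGroundEnergy a ≠ 0) :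
    _root_.RiemannHypothesis :=
  riemannHypothesis_of_even_ne_zero_from (fun _ ha ↦ stub_sectorContinuity_continuousAt_even ha)
    hA hpos h

/-- **Non-vanishing sink, even sector, fully unconditional**: if the even-sector bottom
`ε_ev(a) = weilEvenGroundEnergy a` is non-zero at every window `a > 0`, then RH.  Anchor: the
even bottom dominates the full bottom (`weilGroundEnergy_le_weilEvenGroundEnergy`), which is `≥ 1`
on small windows (`exists_one_le_weilGroundEnergy`); continuity: tree; conclusion: thermometer. -/
theorem riemannHypothesis_of_weilEvenGroundEnergy_ne_zero
    (h : ∀ a : ℝ, 0 < a → weilEvenGroundEnergy a ≠ 0) : _root_.RiemannHypothesis := by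
  have hnn : ∀ a : ℝ, 0 < a → 0 ≤ weilEvenGroundEnergy a := by
    intro a ha
    by_contra hneg
    push Not at hneg
    obtain ⟨a₀, ha₀, hanch⟩ := exists_one_le_weilGroundEnergy
    have hb0 : 0 < min a₀ a := lt_min ha₀ ha
    have hba : min a₀ a ≤ a := min_le_right _ _
    have hb1 : 1 ≤ weilEvenGroundEnergy (min a₀ a) :=
      (hanch _ hb0 (min_le_left _ _)).trans (weilGroundEnergy_le_weilEvenGroundEnergy _)
    have hc : ContinuousOn weilEvenGroundEnergy (Icc (min a₀ a) a) :=
      continuousOn_of_forall_continuousAt fun x hx ↦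
        stub_sectorContinuity_continuousAt_even (hb0.trans_le hx.1)
    have hmem : (0 : ℝ) ∈ Icc (weilEvenGroundEnergy a) (weilEvenGroundEnergy (min a₀ a)) :=
      ⟨hneg.le, by linarith⟩
    obtain ⟨c, hc1, hc0⟩ := intermediate_value_Icc' hba hc hmem
    exact h c (hb0.trans_le hc1.1) hc0
  refine riemannHypothesis_of_evenGroundEnergy_floor (a := fun k : ℕ ↦ (k : ℝ) + 1) (σ := fun _ ↦ 0)
    (tendsto_atTop_add_const_right _ _ tendsto_natCast_atTop_atTop) tendsto_const_nhds ?_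
  exact Eventually.of_forall fun k ↦ by
    have := hnn ((k : ℝ) + 1) (by positivity)
    simpa using this

/-- The harness shape, even sector: a sectorwise window invariant `K` that excludes a vanishing
EVEN bottom is RH-strength once it holds at every window — unconditionally. -/
theorem riemannHypothesis_of_forall_excluding_even_zero {K : ℝ → Prop}
    (hK : ∀ a : ℝ, 0 < a → K a → weilEvenGroundEnergy a ≠ 0) (h : ∀ a : ℝ, 0 < a → K a) :
    _root_.RiemannHypothesis :=
  riemannHypothesis_of_weilEvenGroundEnergy_ne_zero fun a ha ↦ hK a ha (h a ha)

/-- The band instance, unconditional except for the regime anchor: `cand3-006` / `cand3-007`-type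
two-sided laws at every window of `[A, ∞)` with one non-negative even value at `A` give RH. -/
theorem riemannHypothesis_of_bottomStepBand_from' {A : ℝ} (hA : 0 < A)
    (hpos : 0 ≤ weilEvenGroundEnergy A) {s : ℝ} {e₂ e₃ : ℝ → ℝ}
    (h : ∀ a : ℝ, A ≤ a → 0 < e₂ a ∧ 0 < e₃ a ∧ |weilEvenGroundEnergy a| * e₃ a < e₂ a ^ 2 ∧
      e₂ a ^ 2 ≤ s * (|weilEvenGroundEnergy a| * e₃ a)) :
    _root_.RiemannHypothesis :=
  riemannHypothesis_of_even_ne_zero_from' hA hpos fun a ha ↦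
    ne_zero_of_bottomStepBand (h a ha).1 (h a ha).2.2.2

end Summit.RiemannHypothesis.RiemannHypothesis.Theorems.PfPersistenceCand3NonvanishingSink
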